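import Literature.MathematicalPhysics.QuantumFieldTheory.Balaban1983to89.B9Eq3134MatrixConcrete
import Literature.MathematicalPhysics.QuantumFieldTheory.Balaban1983to89.B9Thm311
import Literature.MathematicalPhysics.QuantumFieldTheory.Balaban1983to89.B9SectDForm
import Literature.MathematicalPhysics.QuantumFieldTheory.Balaban1983to89.B9Eq3130Neumann

/-!
# `Balaban1983to89.B9Thm312Positivity` — T. Bałaban, *Propagators for lattice gauge theories in a background field*, Commun. Math. Phys.
**99** (1985) 389–434 [Balaban1985BackgroundPropagators], Sect. D, pp. 421–423: THEOREM 3.12's CLAUSE «THEOREM 3.11 HOLDS FOR THE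
PROPAGATORS G, G₁» BY THE PRINT'S OWN ARGUMENT — the perturbative expansions (3.130) `G = G₀(I − Δ′_πG₀)⁻¹` and (3.138)
`G₁ = G₀(I − (Δ′_π + Δ⁽²⁾_π)G₀)⁻¹` around `G₀ = (Δ + DRD* + Q*aQ)⁻¹` («the operator we have investigated in previous sections», p. 421),
Theorem 3.11 for `Δ_a = Δ + DRD* + Q*aQ` / `G₀`, and the positivity step of Theorem 3.11's proof (p. 416: `G` symmetric, `G₀ > 0`,
`G = G₀(I − R)⁻¹`, `R` small ⟹ `G > 0`) — pub-balaban's `B9Thm311.posDef_of_factor_rowSums` / `posDef_of_factor_spectral` BY NAME — at the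
matrix level of p10's `B9SectDFP` / `B9Eq3152` (`G⁻¹ = Ginv K`, `G₁⁻¹ = G1inv K 𝒞`, `Δ_π = TᵀKT = piOp K`, `Δ⁽²⁾_π = 2Tᵀ𝒞T`); FILE 80 of the
Sect. B–D programme of cell `lit-balaban`, seat r06 (B9 fold owner); rows **B9.Thm3.12** (member cell; head = the lead's word), **B9.Eq3.138**,
**B9.Eq3.130** (member cells)

statement-level skeleton of published theorems with citation tags; proofs where landed; nothing here is a claim about the Yang–Mills mass gap

CITATION HEADER (lean-in-tree rule).  B9 = [Balaban1985BackgroundPropagators] (held `paper:balaban1985-cmp99-background-propagators`, journal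
page = PDF page + 388; text layer pp. 416, 421–423 re-read by this seat 2026-08-24; renders `b2b-balaban-ref1/pages/…-p028/p033/p034/p035-x2.png`).
p. 421 [PDF 33]: «Now we will prove that Theorems 3.3, 3.10, 3.11 hold for the propagators G, G₁. This will be an immediate consequence of
perturbative expansions we will construct. Let us denote for a moment the operator we have investigated in previous sections by G₀, i.e.
G₀ = (Δ + DRD\* + Q\*aQ)⁻¹. From (3.120) we get G = G₀(I − Δ′_πG₀)⁻¹ = Σ_{n=0}^∞ G₀(Δ′_πG₀)ⁿ. (3.130)»; p. 422: «This inequality and Theorem 3.3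
for G₀ imply a convergence of the series (3.130), for α₀ sufficiently small, in all norms …»; p. 423 [PDF 35]: «This bound implies that the
operators Δ⁽²⁾, Δ⁽²⁾_π are small in a proper sense, if α₀ is sufficiently small. Similarly as in (3.130) we get
G₁ = G₀(I − (Δ′_π + Δ⁽²⁾_π)G₀)⁻¹ = Σ_{n=0}^∞ G₀((Δ′_π + Δ⁽²⁾_π)G₀)ⁿ. (3.138) … the series (3.138) is convergent for α₀ restricted by a small,
absolute constant. … Theorem 3.12. If an external gauge field configuration U satisfies both regularity conditions (3.35), (3.36) for α₀
sufficiently small, then Theorems 3.3, 3.10, 3.11 hold for the propagators G, G₁ with one exception …»; Theorem 3.11 p. 416 [PDF 28]: «Under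
the assumptions of the Theorems 3.1–3.10 (i.e. for M sufficiently large and α₀ sufficiently small) the operators Δ′_a, G′, (Q′G′²Q′\*)⁻¹, Δ_a,
G are positive definite.», and its proof: «It is a symmetric and invertible operator, so if it is not positive, then there exists A₀ ≠ 0,
λ₀ > 0 such that GA₀ = −λ₀A₀. By (3.106) G = G₀(I − R)⁻¹, R is an operator with small norm. Let us assume that the operator G₀ is positive
…» (kernel form: pub-balaban `B9Thm311.posDef_of_factor_rowSums`: `G` Hermitian, `G₀ > 0`, `G₀ = G(1 − R)`, row sums of `|R|` ≤ ρ < 1 ⟹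
`G > 0`).  (3.122) p. 420 `G = (Δ_π + DRD* + Q*aQ)⁻¹`; (3.128) p. 421 (`G₁`: the bond form `Δ − 2𝒞`); (3.135) p. 422 `Δ⁽²⁾_π`.

WHAT IS PROVED (kernel; theorems only — 0 `def`, 0 named fact, 0 sorry).
* §1 (abstract square matrices): `isUnit_one_sub_of_rowSums` / `isUnit_one_sub_of_spectral` (sup-smallness of `R`, resp. «no real eigenvalue
  ≥ 1», makes `I − R` invertible — the existence of the sums (3.130)/(3.138) on a finite lattice); `fac_of_resolvent` (the resolvent form
  `G₁ = G₀ + G₁T′G₀` IS `G₀ = G₁(I − T′G₀)`); **`posDef_of_resolvent_rowSums`** / `posDef_of_resolvent_spectral` — THEOREM 3.11's positivity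
  step for an expansion of the shape (3.130)/(3.138): `G₁` symmetric, `G₀ > 0`, `G₁ = G₀ + G₁T′G₀`, row sums of `|T′G₀|` ≤ ρ < 1 ⟹ `G₁ > 0`;
  `abs_eigenvalue_le_of_rowSums_left`, **`posDef_of_resolvent_rowSums_left`**, `isUnit_one_sub_of_rowSums_left` — THE SAME FROM THE LEFT LETTER
  (row sums of `|G₀T′|` ≤ ρ < 1: the derivatives of `T′` absorbed into `G₀`, the product print's p. 423 estimates bound), through the
  similarity `T′G₀ = G₀⁻¹(G₀T′)G₀` and `det(I − T′G₀) = det(I − G₀T′)`.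
* §2 `expansion_identities`, **`expansion_posDef`** / **`expansion_posDef_left`** — THE PRINTED DEFINITION BY THE SERIES: for `G₀ > 0`, `T′`
  symmetric and row sums of `|T′G₀|` (resp. `|G₀T′|`) ≤ ρ < 1, the matrix `G₁ := G₀(I − T′G₀)⁻¹` exists (`I − T′G₀` invertible), satisfies
  `G₁ = G₀ + G₁T′G₀`, inverts `G₀⁻¹ − T′` on both sides, is symmetric, and is POSITIVE DEFINITE.
* §3 AT p10's MATRIX LEVEL (`B9SectDFP`/`B9Eq3152`; `K`, `𝒞` symmetric bond forms, `Δ` symmetric): `G0inv_sub_eq_G1inv` (the identity behind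
  (3.138): `(K + DRD* + aQ_bᵀQ_b) − (Δ′_π + Δ⁽²⁾_π) = G₁⁻¹` with `Δ′_π = K − TᵀKT`, `Δ⁽²⁾_π = 2Tᵀ𝒞T = delta2pi 𝒞`), `G0inv_sub_eq_Ginv` (behind
  (3.130)); **`thm312_posDef_G1`** — from Theorem 3.11 for `Δ_a`-shape `K + DRD* + aQ_bᵀQ_b > 0` (the B09 lineage's standing hypothesis `hΔa`)
  and the sup-smallness of `(Δ′_π + Δ⁽²⁾_π)G₀`: `G₁⁻¹ = G1inv K 𝒞 …` is invertible, `G₁ = G₀(I − (Δ′_π + Δ⁽²⁾_π)G₀)⁻¹` ((3.138), first member),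
  the resolvent form, AND `G₁ > 0`, `G₁⁻¹ > 0` («Theorem 3.11 holds for G₁»); **`thm312_posDef_G1_left`** — the same from the LEFT letter (row
  sums of `|G₀(Δ′_π + Δ⁽²⁾_π)|`); **`thm312_posDef_G`** — the same for `G` of (3.122) from (3.130).
* §4 `rowSums_mul_le` (row sums of `|AB|` ≤ (max row sum of `|A|`)·(max row sum of `|B|`) — feeding §3's letter from separate sup-letters for
  `Δ′_π + Δ⁽²⁾_π` and `G₀`), `rowSum_le_of_mulVec_le` (an `ℓ^∞ → ℓ^∞` bound IS a row-sum bound), and **`rowSums_delta2_calC_le`** — for [5]'s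
  realised `Δ⁽²⁾ = delta2 (calC …)` of FILE 74 the row sums are `≤ [2dC₃‖τ‖(Σ_i‖e_i‖)M_e c₀·#lv]·(Mα₀)` (`norm_delta2_calC_mulVec_le` BY NAME):
  «Δ⁽²⁾ … small in a proper sense».
* §5 (companion, the form route): `posDef_sub_of_form_lt` (`P > 0`, `⟨x,Cx⟩ < ⟨x,Px⟩` ⟹ `P − C > 0`), **`G1inv_posDef_of_form_small`** — `Δ_a > 0` and
  the form-smallness `⟨A,2𝒞A⟩ < ⟨A,Δ_aA⟩` give `K − 2𝒞 + DRD* + aQ_bᵀQ_b > 0`, the input of pub-balaban's `B9Eq3152.G1inv_posDef_of_Δa` (BY NAME),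
  hence `G₁⁻¹ > 0`, `G₁ > 0`.
* §6 **`thm312_G1_sandwich`** — pub-balaban r1's (N′) route `B9SectDForm.G1_sandwich` BY NAME, instantiated at p10's level: `Δ_a` coercive
  (`γ > 0`), `|⟨A,(Δ′_π + Δ⁽²⁾_π)A⟩| ≤ r⟨A,Δ_aA⟩`, `r < 1` ⟹ `G1inv K 𝒞 …` coercive with `(1 − r)γ` and `(1 + r)⁻¹G₀ ≤ G₁ ≤ (1 − r)⁻¹G₀` as forms.
* §7 `linfty_opNorm_le_of_rowSums` (row sums ≤ ρ IS `‖·‖_{∞→∞} ≤ ρ`, Mathlib's `Matrix.linftyOpNormedRing`), **`eq3138_hasSum_posDef`** — (3.138)'s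
  SECOND MEMBER at p10's level: the series `Σ_n G₀((Δ′_π + Δ⁽²⁾_π)G₀)ⁿ` converges in the sup operator norm to `(G1inv K 𝒞 …)⁻¹`, which is positive
  definite — r06 FILE 68's normed-ring `B9Eq3130Neumann.eq3138_hasSum` instantiated at the letters `Δ := K`, `DRD* := DRDᵀ`, `Q*aQ := a·Q_bᵀQ_b`,
  `Δ′_π := K − TᵀKT`, `Δ⁽²⁾_π := 2Tᵀ𝒞T` (BY NAME) + §3; `eq3130_hasSum_posDef` — the twin for `G` of (3.122) and the series (3.130);
  **`eq3138_hasSum_posDef_left`** — the series from the LEFT letter (`Σ_n (G₀T′)ⁿG₀`, pub-balaban r1 `B9SectDForm.neumann_term_eq`, Mathlib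
  `hasSum_geom_series_inverse`).
* §8 **`rowSum_le_of_hasMaj_ofBlocks`**, `rowSum_le_of_hasMaj_exp` — BLOCK MAJORANT ⟹ SUP LETTER: a block majorant `K ≥ 0` of `M` between the
  sharp-block sup norms (`B11SectG.HasMaj (ofBlocks blk) (ofBlocks blk)`, the shape r06 FILE 78 / pub-balaban r1 `B9SectDSup` deliver for
  `G₀(Δ′_π + Δ⁽²⁾_π)`) gives `Σ_{x′}|M(x,x′)| ≤ Σ_{y′}K(y(x),y′)`, hence `≤ C·c` for `K = C·e^{−δd}` with the row sum [4] (2.61) — the input of the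
  `_left` theorems.

HONEST SCOPE / NOT CLAIMED.  (i) The smallness input is a LETTER, offered in four shapes: row sums of `|G₀(Δ′_π + Δ⁽²⁾_π)|` ≤ ρ < 1 (the
`_left` variants — the sup reading of «the series (3.138) is convergent for α₀ restricted by a small, absolute constant» for the product print
estimates, the derivatives of `Δ′_π`, `Δ⁽²⁾_π = TᵀΔ⁽²⁾T` «applied … to the operator on the left», p. 423 — the outer `D` of `Tᵀ = I − DRG′D*`
absorbed into the neighbouring `G₀`, cf. (3.44)–(3.45) and r06 FILES 77/78's factored `𝒢∘(𝒯₁ + 𝒯₂)`), row sums of `|(Δ′_π + Δ⁽²⁾_π)G₀|` (the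
right letter: kernel-true as a hypothesis but STRONGER than what p. 423 estimates — located, zero weight), the minimal spectral input (no real
eigenvalue `≥ 1` of `(Δ′_π + Δ⁽²⁾_π)G₀`), and §5–§6's FORM smallness (the bilinear shape in which (3.131)/(3.137) are printed).  Feeding any of
them is rows 3.120/3.131 (`Δ′_π`), Theorem 3.3 (`G₀`), Theorem 3.1 ∘ (3.49) and (3.44) (`T`) — by reference; §4 reduces a sup letter to letters
for the factors and discharges only the undressed `Δ⁽²⁾` piece for [5]'s concrete second-order form; the passage from a block majorant
(`B11SectG.HasMaj` on the sharp-block sup norms) to row sums is §8.  The «state» block norm `bC` of FILES 77/78 is abstract there; §8 needs it to be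
`ofBlocks` (sup over the block) — print's state norms carry `|D*A|`-type terms as well ((3.131)), not modelled here.  (ii) Theorem 3.11 for `Δ_a`/`G₀` enters as the hypothesis `hΔa` (= pub-balaban's standing input of
`B9Eq3147.eq_3153`, `B9SectDFP.Ginv_posDef_of_Δa`; on concrete lattices rows 3.111/Thm3.11: `B9Thm311Lattice`, NE9's coercivity files).  (iii) The
B09 lineage ALREADY has `G⁻¹ > 0`, `G₁⁻¹ > 0` from `Δ_a`-shaped inputs by exact quadratic-form identities (`B9SectDFP.Ginv_posDef_of_Δa`,
`B9Eq3152.G1inv_posDef_of_Δa` — the latter ASSUMING `K − 2𝒞 + DRD* + aQ_bᵀQ_b > 0`); this file is the print's perturbative route, whose input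
is the sup-smallness of the expansion instead.  (iv) Finite index types (one finite lattice at a time); `K`, `𝒞` are letters for the bond
Laplace form `Δ` of (3.118) and [5]'s `𝒞` (FILE 74 makes `𝒞` concrete; §4 uses it only through `delta2`).  (v) Theorems 3.3/3.10 for `G`, `G₁`
(rows 3.130/3.138's analytic content) are NOT treated here (FILES 76–78, `B9SectDSup`).  Constants explicit.  NOT summit progress.

RELATED IN THE TREE, NOT DUPLICATED (searched 2026-08-24: stems `*Thm311*`, `*Thm312*`, `*3130*`, `*3138*`, `*posDef*G1*`): pub-balaban
`B9Thm311` (USED), `B9Thm311Data`/`B9Thm311Lattice` («obvious for the first three»), `B9SectDFP.Ginv_posDef(_of_slicePos/_of_Δa)`,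
`B9Eq3152.G1inv_posDef(_of_slicePos/_of_Δa)`, `B9Delta2Def134` (USED: `G1inv_eq_Ginv_sub_two_piOp`, `delta2pi`), pub-balaban r1
`B9SectDForm` (the FORM route (N′) with the sandwich and the energy-norm bound on the Neumann terms — `G1_sandwich` USED in §6; §5's six-line
`posDef_sub_of_form_lt` is only the `PosDef`-language bridge to `B9Eq3152.G1inv_posDef_of_Δa`); r06 FILE 68 `B9Eq3130Neumann`
((3.130)/(3.138) as printed at the NORMED-RING letter level — `eq3130_inverse_form`/`eq3138_inverse_form`/`_series`/`_hasSum`/`_fixedPoint` under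
`‖(Δ′_π + Δ⁽²⁾_π)G₀‖ < 1`; USED in §7 with Mathlib's sup operator norm on matrices; §2–§3 derive the inverse form at p10's matrix level from the
row-sum letter by ten lines of algebra because the positivity step needs the matrix (eigenvalue) form), FILES 76–78 ((3.138) entry bookkeeping), FILE 74
`B9Eq3134MatrixConcrete` (USED: `norm_delta2_calC_mulVec_le`).  Unit `lit-balaban-r06`, HOME `run/shared/lean/pub/lit-balaban/`.
-/

noncomputable section

open scoped BigOperators Matrix

namespace Literature.MathematicalPhysics.QuantumFieldTheory.Balaban1983to89.B9Thm312Positivity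

open Literature.MathematicalPhysics.QuantumFieldTheory.Balaban1983to89
open Matrix

/-! ## §1 Theorem 3.11's positivity step for an expansion `G₁ = G₀ + G₁T′G₀` (p. 416 with (3.130)/(3.138)) -/

section Abstract

variable {X : Type*} [Fintype X] [DecidableEq X]

/-- sup-smallness `Σ_j |R(i,j)| ≤ ρ < 1` makes `I − R` invertible (a real eigenvalue `1` is excluded by pub-balaban's
`B9Thm311.abs_eigenvalue_le_of_row_sums`) — on a finite lattice this is the existence of the sum `Σ_n Rⁿ` of (3.130)/(3.138).
[cite: Balaban1985BackgroundPropagators, (3.138) p.423, (3.130) p.421] -/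
theorem isUnit_one_sub_of_rowSums (R : Matrix X X ℝ) {ρ : ℝ} (hρ : ρ < 1) (hrow : ∀ i, ∑ j, |R i j| ≤ ρ) :
    IsUnit (1 - R) := by
  rw [← Matrix.mulVec_injective_iff_isUnit]
  intro v w h
  by_contra hne
  have hvw : v - w ≠ 0 := sub_ne_zero.mpr hne
  have h0 : (1 - R) *ᵥ (v - w) = 0 := by rw [Matrix.mulVec_sub, h, sub_self]
  have hR : R *ᵥ (v - w) = (1 : ℝ) • (v - w) := by
    rw [Matrix.sub_mulVec, Matrix.one_mulVec, sub_eq_zero] at h0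
    rw [one_smul]; exact h0.symm
  have h1 := B9Thm311.abs_eigenvalue_le_of_row_sums R hrow 1 (v - w) hvw hR
  rw [abs_one] at h1
  linarith

/-- the minimal input: no real eigenvalue `≥ 1` of `R` ⟹ `I − R` invertible — the existence of the sums (3.130)/(3.138) on a finite lattice.
[cite: Balaban1985BackgroundPropagators, (3.138) p.423, (3.130) p.421] -/
theorem isUnit_one_sub_of_spectral (R : Matrix X X ℝ) (hR : ∀ (μ : ℝ) (w : X → ℝ), w ≠ 0 → R *ᵥ w = μ • w → μ < 1) :
    IsUnit (1 - R) := by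
  rw [← Matrix.mulVec_injective_iff_isUnit]
  intro v w h
  by_contra hne
  have hvw : v - w ≠ 0 := sub_ne_zero.mpr hne
  have h0 : (1 - R) *ᵥ (v - w) = 0 := by rw [Matrix.mulVec_sub, h, sub_self]
  have hRv : R *ᵥ (v - w) = (1 : ℝ) • (v - w) := by
    rw [Matrix.sub_mulVec, Matrix.one_mulVec, sub_eq_zero] at h0
    rw [one_smul]; exact h0.symm
  exact lt_irrefl _ (hR 1 (v - w) hvw hRv)

/-- the resolvent form `G₁ = G₀ + G₁T′G₀` of (3.138)/(3.130) IS the factorisation `G₀ = G₁(I − T′G₀)` of Theorem 3.11's proof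
(p. 416: «G = G₀(I − R)⁻¹»). [cite: Balaban1985BackgroundPropagators, (3.138) p.423, Thm 3.11 p.416] -/
theorem fac_of_resolvent (G1 G0 Tp : Matrix X X ℝ) (h : G1 = G0 + G1 * Tp * G0) : G0 = G1 * (1 - Tp * G0) := by
  rw [Matrix.mul_sub, Matrix.mul_one, ← Matrix.mul_assoc]
  exact eq_sub_of_add_eq h.symm

/-- **THEOREM 3.11's POSITIVITY STEP FOR THE EXPANSION (3.138)/(3.130)** (p. 416, pub-balaban `B9Thm311.posDef_of_factor_rowSums` BY NAME):
`G₁` symmetric, `G₀` positive definite, `G₁ = G₀ + G₁T′G₀` and row sums of `|T′G₀|` ≤ ρ < 1 (the sup-smallness making the series converge)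
⟹ `G₁` positive definite. [cite: Balaban1985BackgroundPropagators, Thm 3.12 p.423, Thm 3.11 p.416, (3.138) p.423] -/
theorem posDef_of_resolvent_rowSums (G1 G0 Tp : Matrix X X ℝ) (hG1 : G1.IsHermitian) (hG0 : G0.PosDef)
    (h : G1 = G0 + G1 * Tp * G0) {ρ : ℝ} (hρ : ρ < 1) (hrow : ∀ i, ∑ j, |(Tp * G0) i j| ≤ ρ) : G1.PosDef :=
  B9Thm311.posDef_of_factor_rowSums G1 G0 (Tp * G0) hG1 hG0 (fac_of_resolvent G1 G0 Tp h) hρ hrow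

/-- the same from the minimal input (no real eigenvalue `≥ 1` of `T′G₀`; pub-balaban `B9Thm311.posDef_of_factor_spectral`).
[cite: Balaban1985BackgroundPropagators, Thm 3.12 p.423, Thm 3.11 p.416] -/
theorem posDef_of_resolvent_spectral (G1 G0 Tp : Matrix X X ℝ) (hG1 : G1.IsHermitian) (hG0 : G0.PosDef)
    (h : G1 = G0 + G1 * Tp * G0) (hR : ∀ (μ : ℝ) (w : X → ℝ), w ≠ 0 → (Tp * G0) *ᵥ w = μ • w → μ < 1) : G1.PosDef :=
  B9Thm311.posDef_of_factor_spectral G1 G0 (Tp * G0) hG1 hG0 (fac_of_resolvent G1 G0 Tp h) hR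

/-- the spectral input from the LEFT sup letter «derivatives … applied … to the operator on the left» (p. 423): `T′G₀ = G₀⁻¹(G₀T′)G₀` is
similar to `G₀T′`, so a real eigenvalue `μ` of `T′G₀` is one of `G₀T′` and `|μ|` ≤ (max row sum of `|G₀T′|`) — pub-balaban
`B9Thm311.abs_eigenvalue_le_of_row_sums` on `G₀T′`. [cite: Balaban1985BackgroundPropagators, (3.138) p.423, Thm 3.11 p.416] -/
theorem abs_eigenvalue_le_of_rowSums_left (G0 Tp : Matrix X X ℝ) (hG0 : IsUnit G0.det) {ρ : ℝ} (hrow : ∀ i, ∑ j, |(G0 * Tp) i j| ≤ ρ)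
    (μ : ℝ) (w : X → ℝ) (hw : w ≠ 0) (h : (Tp * G0) *ᵥ w = μ • w) : |μ| ≤ ρ := by
  have hinj : Function.Injective G0.mulVec := (Matrix.mulVec_injective_iff_isUnit).mpr ((Matrix.isUnit_iff_isUnit_det _).mpr hG0)
  have hv : G0 *ᵥ w ≠ 0 := fun h0 => hw (hinj (by rw [h0, Matrix.mulVec_zero]))
  have h' : (G0 * Tp) *ᵥ (G0 *ᵥ w) = μ • (G0 *ᵥ w) := by
    rw [← Matrix.mulVec_mulVec] at h
    rw [← Matrix.mulVec_mulVec, h, Matrix.mulVec_smul]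
  exact B9Thm311.abs_eigenvalue_le_of_row_sums (G0 * Tp) hrow μ (G0 *ᵥ w) hv h'

/-- **THEOREM 3.11's POSITIVITY STEP FROM THE LEFT LETTER**: `G₁` symmetric, `G₀ > 0`, `G₁ = G₀ + G₁T′G₀` and row sums of `|G₀T′|` ≤ ρ < 1 —
the sup-smallness of the product with the derivatives of `T′ = Δ′_π + Δ⁽²⁾_π` ABSORBED INTO `G₀` on the left, the form print estimates
(p. 423; r06 FILE 78's `𝒢∘(𝒯₁ + 𝒯₂)`) — ⟹ `G₁ > 0`. [cite: Balaban1985BackgroundPropagators, Thm 3.12 p.423, Thm 3.11 p.416, (3.138) p.423] -/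
theorem posDef_of_resolvent_rowSums_left (G1 G0 Tp : Matrix X X ℝ) (hG1 : G1.IsHermitian) (hG0 : G0.PosDef)
    (h : G1 = G0 + G1 * Tp * G0) {ρ : ℝ} (hρ : ρ < 1) (hrow : ∀ i, ∑ j, |(G0 * Tp) i j| ≤ ρ) : G1.PosDef :=
  posDef_of_resolvent_spectral G1 G0 Tp hG1 hG0 h fun μ w hw hμ =>
    lt_of_le_of_lt (le_abs_self μ) (lt_of_le_of_lt
      (abs_eigenvalue_le_of_rowSums_left G0 Tp ((Matrix.isUnit_iff_isUnit_det _).mp hG0.isUnit) hrow μ w hw hμ) hρ)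

/-- the left letter also gives the existence: `det(I − T′G₀) = det(I − G₀T′)` (Mathlib `Matrix.det_one_sub_mul_comm`).
[cite: Balaban1985BackgroundPropagators, (3.138) p.423] -/
theorem isUnit_one_sub_of_rowSums_left (G0 Tp : Matrix X X ℝ) {ρ : ℝ} (hρ : ρ < 1) (hrow : ∀ i, ∑ j, |(G0 * Tp) i j| ≤ ρ) :
    IsUnit (1 - Tp * G0) := by
  rw [Matrix.isUnit_iff_isUnit_det, Matrix.det_one_sub_mul_comm]
  exact (Matrix.isUnit_iff_isUnit_det _).mp (isUnit_one_sub_of_rowSums (G0 * Tp) hρ hrow)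

end Abstract

/-! ## §2 The printed definition by the series: `G₁ := G₀(I − T′G₀)⁻¹` exists, is symmetric, inverts `G₀⁻¹ − T′`, and is positive -/

section Expansion

variable {X : Type*} [Fintype X] [DecidableEq X]

omit [Fintype X] [DecidableEq X] in
/-- over `ℝ`, `IsHermitian` is symmetry. [folklore] -/
private theorem isHermitian_of_transpose_eq {A : Matrix X X ℝ} (h : Aᵀ = A) : A.IsHermitian := by
  unfold Matrix.IsHermitian
  rw [Matrix.conjTranspose_eq_transpose_of_trivial, h]

omit [Fintype X] [DecidableEq X] in
/-- a real positive definite matrix is symmetric. [folklore] -/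
private theorem transpose_eq_of_posDef {A : Matrix X X ℝ} (h : A.PosDef) : Aᵀ = A := by
  rw [← Matrix.conjTranspose_eq_transpose_of_trivial]
  exact h.isHermitian

/-- the algebra of the printed definition by the series: for `G₀ > 0`, `T′` symmetric and `I − T′G₀` invertible, `G₁ := G₀(I − T′G₀)⁻¹`
satisfies `G₁ = G₀ + G₁T′G₀`, `(G₀⁻¹ − T′)G₁ = I = G₁(G₀⁻¹ − T′)`, and is symmetric. [cite: Balaban1985BackgroundPropagators, (3.138) p.423, (3.130) p.421] -/
theorem expansion_identities (G0 Tp : Matrix X X ℝ) (hG0 : G0.PosDef) (hTp : Tpᵀ = Tp) (hU : IsUnit (1 - Tp * G0)) :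
    G0 * (1 - Tp * G0)⁻¹ = G0 + G0 * (1 - Tp * G0)⁻¹ * Tp * G0 ∧
    (G0⁻¹ - Tp) * (G0 * (1 - Tp * G0)⁻¹) = 1 ∧
    G0 * (1 - Tp * G0)⁻¹ * (G0⁻¹ - Tp) = 1 ∧
    (G0 * (1 - Tp * G0)⁻¹)ᵀ = G0 * (1 - Tp * G0)⁻¹ := by
  have hUdet : IsUnit (1 - Tp * G0).det := (Matrix.isUnit_iff_isUnit_det _).mp hU
  have hG0det : IsUnit G0.det := (Matrix.isUnit_iff_isUnit_det _).mp hG0.isUnit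
  have hG0t : G0ᵀ = G0 := transpose_eq_of_posDef hG0
  set G1 : Matrix X X ℝ := G0 * (1 - Tp * G0)⁻¹ with hG1
  clear_value G1
  -- the resolvent identity
  have hres' : G1 * (1 - Tp * G0) = G0 := by
    rw [hG1, Matrix.mul_assoc, Matrix.nonsing_inv_mul _ hUdet, Matrix.mul_one]
  have hres : G1 = G0 + G1 * Tp * G0 := by
    have h2 : G1 * (1 - Tp * G0) = G1 - G1 * Tp * G0 := by rw [Matrix.mul_sub, Matrix.mul_one, Matrix.mul_assoc]
    rw [h2] at hres'
    exact (sub_eq_iff_eq_add.mp hres')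
  -- left inverse of `G₀⁻¹ − T′`
  have hleft : (G0⁻¹ - Tp) * G1 = 1 := by
    have h3 : (G0⁻¹ - Tp) * G0 = 1 - Tp * G0 := by rw [Matrix.sub_mul, Matrix.nonsing_inv_mul _ hG0det]
    rw [hG1, ← Matrix.mul_assoc, h3, Matrix.mul_nonsing_inv _ hUdet]
  have hright : G1 * (G0⁻¹ - Tp) = 1 := mul_eq_one_comm.mp hleft
  -- symmetry: `G₁ᵀ` is also a left inverse of the symmetric `G₀⁻¹ − T′`
  have hMt : (G0⁻¹ - Tp)ᵀ = G0⁻¹ - Tp := by rw [Matrix.transpose_sub, Matrix.transpose_nonsing_inv, hG0t, hTp]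
  have hleft' : G1ᵀ * (G0⁻¹ - Tp) = 1 := by
    have h4 : G1ᵀ * (G0⁻¹ - Tp)ᵀ = ((G0⁻¹ - Tp) * G1)ᵀ := (Matrix.transpose_mul _ _).symm
    rw [hMt, hleft, Matrix.transpose_one] at h4
    exact h4
  have hsymm : G1ᵀ = G1 := by
    calc G1ᵀ = G1ᵀ * ((G0⁻¹ - Tp) * G1) := by rw [hleft, Matrix.mul_one]
      _ = G1ᵀ * (G0⁻¹ - Tp) * G1 := by rw [Matrix.mul_assoc]
      _ = G1 := by rw [hleft', Matrix.one_mul]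
  exact ⟨hres, hleft, hright, hsymm⟩

/-- **(3.138)/(3.130) AS A DEFINITION, WITH THEOREM 3.11'S CONCLUSION**: `G₀ > 0`, `T′` symmetric, row sums of `|T′G₀|` ≤ ρ < 1 ⟹ for
`G₁ := G₀(I − T′G₀)⁻¹`: `I − T′G₀` is invertible; `G₁ = G₀ + G₁T′G₀`; `(G₀⁻¹ − T′)G₁ = I = G₁(G₀⁻¹ − T′)`; `G₁` is symmetric; `G₁ > 0`.
[cite: Balaban1985BackgroundPropagators, (3.138) p.423, (3.130) p.421, Thm 3.12 p.423, Thm 3.11 p.416] -/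
theorem expansion_posDef (G0 Tp : Matrix X X ℝ) (hG0 : G0.PosDef) (hTp : Tpᵀ = Tp) {ρ : ℝ} (hρ : ρ < 1)
    (hrow : ∀ i, ∑ j, |(Tp * G0) i j| ≤ ρ) :
    IsUnit (1 - Tp * G0) ∧
    G0 * (1 - Tp * G0)⁻¹ = G0 + G0 * (1 - Tp * G0)⁻¹ * Tp * G0 ∧
    (G0⁻¹ - Tp) * (G0 * (1 - Tp * G0)⁻¹) = 1 ∧
    G0 * (1 - Tp * G0)⁻¹ * (G0⁻¹ - Tp) = 1 ∧
    (G0 * (1 - Tp * G0)⁻¹)ᵀ = G0 * (1 - Tp * G0)⁻¹ ∧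
    (G0 * (1 - Tp * G0)⁻¹).PosDef := by
  have hU : IsUnit (1 - Tp * G0) := isUnit_one_sub_of_rowSums (Tp * G0) hρ hrow
  obtain ⟨hres, hleft, hright, hsymm⟩ := expansion_identities G0 Tp hG0 hTp hU
  exact ⟨hU, hres, hleft, hright, hsymm,
    posDef_of_resolvent_rowSums _ G0 Tp (isHermitian_of_transpose_eq hsymm) hG0 hres hρ hrow⟩

/-- **THE SAME FROM THE LEFT LETTER** (row sums of `|G₀T′|` ≤ ρ < 1 — derivatives absorbed into `G₀`, the form p. 423 estimates).
[cite: Balaban1985BackgroundPropagators, (3.138) p.423, Thm 3.12 p.423, Thm 3.11 p.416] -/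
theorem expansion_posDef_left (G0 Tp : Matrix X X ℝ) (hG0 : G0.PosDef) (hTp : Tpᵀ = Tp) {ρ : ℝ} (hρ : ρ < 1)
    (hrow : ∀ i, ∑ j, |(G0 * Tp) i j| ≤ ρ) :
    IsUnit (1 - Tp * G0) ∧
    G0 * (1 - Tp * G0)⁻¹ = G0 + G0 * (1 - Tp * G0)⁻¹ * Tp * G0 ∧
    (G0⁻¹ - Tp) * (G0 * (1 - Tp * G0)⁻¹) = 1 ∧
    G0 * (1 - Tp * G0)⁻¹ * (G0⁻¹ - Tp) = 1 ∧
    (G0 * (1 - Tp * G0)⁻¹)ᵀ = G0 * (1 - Tp * G0)⁻¹ ∧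
    (G0 * (1 - Tp * G0)⁻¹).PosDef := by
  have hU : IsUnit (1 - Tp * G0) := isUnit_one_sub_of_rowSums_left G0 Tp hρ hrow
  obtain ⟨hres, hleft, hright, hsymm⟩ := expansion_identities G0 Tp hG0 hTp hU
  exact ⟨hU, hres, hleft, hright, hsymm,
    posDef_of_resolvent_rowSums_left _ G0 Tp (isHermitian_of_transpose_eq hsymm) hG0 hres hρ hrow⟩

end Expansion

/-! ## §3 At p10's matrix level: «Theorem 3.11 holds for the propagators G, G₁» from (3.130)/(3.138) -/

section SectD

variable {n m b q : Type*} [Fintype n] [Fintype m] [Fintype b] [Fintype q] [DecidableEq n] [DecidableEq m] [DecidableEq b]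

/-- `Δ_π = TᵀKT` is symmetric for symmetric `K`. [cite: Balaban1985BackgroundPropagators, (3.119)–(3.120) p.419] -/
theorem piOp_transpose (K : Matrix b b ℝ) (hK : Kᵀ = K) (Δ : Matrix n n ℝ) (Q : Matrix m n ℝ) (a : ℝ) (D : Matrix b n ℝ) :
    (B9SectDFP.piOp K Δ Q a D)ᵀ = B9SectDFP.piOp K Δ Q a D := by
  rw [B9SectDFP.piOp, Matrix.transpose_mul, Matrix.transpose_mul, Matrix.transpose_transpose, hK, Matrix.mul_assoc]

/-- the identity behind (3.138): `G₀⁻¹ − (Δ′_π + Δ⁽²⁾_π) = G₁⁻¹` with `G₀⁻¹ = K + DRD* + aQ_bᵀQ_b`, `Δ′_π = K − TᵀKT` ((3.120): `Δ_π = Δ − Δ′_π`),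
`Δ⁽²⁾_π = 2Tᵀ𝒞T` ((3.135)), `G₁⁻¹ = Tᵀ(K − 2𝒞)T + DRD* + aQ_bᵀQ_b` ((3.128), `B9Eq3152.G1inv`).
[cite: Balaban1985BackgroundPropagators, (3.138) p.423, (3.128) p.421, (3.120) p.419] -/
theorem G0inv_sub_eq_G1inv (K C : Matrix b b ℝ) (Δ : Matrix n n ℝ) (Q : Matrix m n ℝ) (a : ℝ) (D : Matrix b n ℝ)
    (Qb : Matrix q b ℝ) (ab : ℝ) :
    (K + D * B9H163.R Δ Q a * Dᵀ + ab • (Qbᵀ * Qb)) -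
        ((K - B9SectDFP.piOp K Δ Q a D) + (2 : ℝ) • B9SectDFP.piOp C Δ Q a D) = B9Eq3152.G1inv K C Δ Q a D Qb ab := by
  rw [B9Delta2Def134.G1inv_eq_Ginv_sub_two_piOp, B9SectDFP.Ginv]
  abel

/-- the identity behind (3.130): `G₀⁻¹ − Δ′_π = G⁻¹ = Δ_π + DRD* + aQ_bᵀQ_b` ((3.122), `B9SectDFP.Ginv`).
[cite: Balaban1985BackgroundPropagators, (3.130) p.421, (3.122) p.420] -/
theorem G0inv_sub_eq_Ginv (K : Matrix b b ℝ) (Δ : Matrix n n ℝ) (Q : Matrix m n ℝ) (a : ℝ) (D : Matrix b n ℝ)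
    (Qb : Matrix q b ℝ) (ab : ℝ) :
    (K + D * B9H163.R Δ Q a * Dᵀ + ab • (Qbᵀ * Qb)) - (K - B9SectDFP.piOp K Δ Q a D) = B9SectDFP.Ginv K Δ Q a D Qb ab := by
  rw [B9SectDFP.Ginv]
  abel

/-- for symmetric `𝒞`, `2Tᵀ𝒞T = Δ⁽²⁾_π` of p10's `B9Delta2Def134.delta2pi`. [cite: Balaban1985BackgroundPropagators, (3.135) p.422] -/
theorem two_smul_piOp_eq_delta2pi (C : Matrix b b ℝ) (hC : Cᵀ = C) (Δ : Matrix n n ℝ) (Q : Matrix m n ℝ) (a : ℝ)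
    (D : Matrix b n ℝ) : (2 : ℝ) • B9SectDFP.piOp C Δ Q a D = B9Delta2Def134.delta2pi C Δ Q a D := by
  rw [B9Delta2Def134.delta2pi, B9Delta2Def134.delta2_of_symm C hC, B9SectDFP.piOp, B9SectDFP.piOp, Matrix.mul_smul,
    Matrix.smul_mul]

/-- shared core of `thm312_posDef_G1` / `thm312_posDef_G1_left`: from the six conclusions of `expansion_posDef(_left)` at `G₀ = Δ_a⁻¹`,
`T′ = Δ′_π + Δ⁽²⁾_π` to the statements about `G1inv`. [folklore] -/
private theorem thm312_G1_core (K C : Matrix b b ℝ) (Δ : Matrix n n ℝ) (Q : Matrix m n ℝ) (a : ℝ) (D : Matrix b n ℝ)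
    (Qb : Matrix q b ℝ) (ab : ℝ) (hΔa : (K + D * B9H163.R Δ Q a * Dᵀ + ab • (Qbᵀ * Qb)).PosDef)
    (hexp : let G0 := (K + D * B9H163.R Δ Q a * Dᵀ + ab • (Qbᵀ * Qb))⁻¹
      let Tp := (K - B9SectDFP.piOp K Δ Q a D) + (2 : ℝ) • B9SectDFP.piOp C Δ Q a D
      IsUnit (1 - Tp * G0) ∧ G0 * (1 - Tp * G0)⁻¹ = G0 + G0 * (1 - Tp * G0)⁻¹ * Tp * G0 ∧ (G0⁻¹ - Tp) * (G0 * (1 - Tp * G0)⁻¹) = 1 ∧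
        G0 * (1 - Tp * G0)⁻¹ * (G0⁻¹ - Tp) = 1 ∧ (G0 * (1 - Tp * G0)⁻¹)ᵀ = G0 * (1 - Tp * G0)⁻¹ ∧ (G0 * (1 - Tp * G0)⁻¹).PosDef) :
    IsUnit (B9Eq3152.G1inv K C Δ Q a D Qb ab).det ∧
    (B9Eq3152.G1inv K C Δ Q a D Qb ab)⁻¹ =
      (K + D * B9H163.R Δ Q a * Dᵀ + ab • (Qbᵀ * Qb))⁻¹ *
        (1 - ((K - B9SectDFP.piOp K Δ Q a D) + (2 : ℝ) • B9SectDFP.piOp C Δ Q a D) *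
          (K + D * B9H163.R Δ Q a * Dᵀ + ab • (Qbᵀ * Qb))⁻¹)⁻¹ ∧
    (B9Eq3152.G1inv K C Δ Q a D Qb ab)⁻¹ =
      (K + D * B9H163.R Δ Q a * Dᵀ + ab • (Qbᵀ * Qb))⁻¹ +
        (B9Eq3152.G1inv K C Δ Q a D Qb ab)⁻¹ * ((K - B9SectDFP.piOp K Δ Q a D) + (2 : ℝ) • B9SectDFP.piOp C Δ Q a D) *
          (K + D * B9H163.R Δ Q a * Dᵀ + ab • (Qbᵀ * Qb))⁻¹ ∧
    ((B9Eq3152.G1inv K C Δ Q a D Qb ab)⁻¹).PosDef ∧ (B9Eq3152.G1inv K C Δ Q a D Qb ab).PosDef := by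
  set G0inv : Matrix b b ℝ := K + D * B9H163.R Δ Q a * Dᵀ + ab • (Qbᵀ * Qb) with hG0inv
  set Tp : Matrix b b ℝ := (K - B9SectDFP.piOp K Δ Q a D) + (2 : ℝ) • B9SectDFP.piOp C Δ Q a D with hTpdef
  have hG0idet : IsUnit G0inv.det := (Matrix.isUnit_iff_isUnit_det _).mp hΔa.isUnit
  obtain ⟨-, hres, hleft, -, -, hpos⟩ := hexp
  -- `G₀⁻¹⁻¹ − T′ = G₁⁻¹`
  have hM : G0inv⁻¹⁻¹ - Tp = B9Eq3152.G1inv K C Δ Q a D Qb ab := by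
    rw [Matrix.nonsing_inv_nonsing_inv _ hG0idet, hG0inv, hTpdef]
    exact G0inv_sub_eq_G1inv K C Δ Q a D Qb ab
  rw [hM] at hleft
  have hdet : IsUnit (B9Eq3152.G1inv K C Δ Q a D Qb ab).det := Matrix.isUnit_det_of_right_inverse hleft
  have hinv : (B9Eq3152.G1inv K C Δ Q a D Qb ab)⁻¹ = G0inv⁻¹ * (1 - Tp * G0inv⁻¹)⁻¹ := Matrix.inv_eq_right_inv hleft
  refine ⟨hdet, hinv, ?_, ?_, ?_⟩
  · rw [hinv]; exact hres
  · rw [hinv]; exact hpos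
  · have h := (hinv ▸ hpos : ((B9Eq3152.G1inv K C Δ Q a D Qb ab)⁻¹).PosDef).inv
    rwa [Matrix.nonsing_inv_nonsing_inv _ hdet] at h

/-- **THEOREM 3.12, THE CLAUSE «THEOREM 3.11 HOLDS FOR G₁», BY (3.138)** — at p10's matrix level: `K`, `𝒞` symmetric bond forms;
`G₀⁻¹ := K + DRD* + aQ_bᵀQ_b` positive definite (Theorem 3.11 for `Δ_a`; the B09 lineage's `hΔa`), `T′ := Δ′_π + Δ⁽²⁾_π = (K − TᵀKT) + 2Tᵀ𝒞T`
with row sums of `|T′G₀|` ≤ ρ < 1 (the sup-smallness of the expansion (3.138), RIGHT letter) ⟹ `G₁⁻¹ = G1inv K 𝒞 …` of (3.128) is invertible,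
`G₁ = G₀(I − T′G₀)⁻¹` ((3.138)), `G₁ = G₀ + G₁T′G₀`, and `G₁ > 0`, `G₁⁻¹ > 0`.
[cite: Balaban1985BackgroundPropagators, Thm 3.12 p.423, (3.138) p.423, Thm 3.11 p.416, (3.128) p.421] -/
theorem thm312_posDef_G1 (K C : Matrix b b ℝ) (hK : Kᵀ = K) (hC : Cᵀ = C) (Δ : Matrix n n ℝ) (Q : Matrix m n ℝ) (a : ℝ)
    (D : Matrix b n ℝ) (Qb : Matrix q b ℝ) (ab : ℝ)
    (hΔa : (K + D * B9H163.R Δ Q a * Dᵀ + ab • (Qbᵀ * Qb)).PosDef) {ρ : ℝ} (hρ : ρ < 1)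
    (hrow : ∀ i, ∑ j, |(((K - B9SectDFP.piOp K Δ Q a D) + (2 : ℝ) • B9SectDFP.piOp C Δ Q a D) *
      (K + D * B9H163.R Δ Q a * Dᵀ + ab • (Qbᵀ * Qb))⁻¹) i j| ≤ ρ) :
    IsUnit (B9Eq3152.G1inv K C Δ Q a D Qb ab).det ∧
    (B9Eq3152.G1inv K C Δ Q a D Qb ab)⁻¹ =
      (K + D * B9H163.R Δ Q a * Dᵀ + ab • (Qbᵀ * Qb))⁻¹ *
        (1 - ((K - B9SectDFP.piOp K Δ Q a D) + (2 : ℝ) • B9SectDFP.piOp C Δ Q a D) *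
          (K + D * B9H163.R Δ Q a * Dᵀ + ab • (Qbᵀ * Qb))⁻¹)⁻¹ ∧
    (B9Eq3152.G1inv K C Δ Q a D Qb ab)⁻¹ =
      (K + D * B9H163.R Δ Q a * Dᵀ + ab • (Qbᵀ * Qb))⁻¹ +
        (B9Eq3152.G1inv K C Δ Q a D Qb ab)⁻¹ * ((K - B9SectDFP.piOp K Δ Q a D) + (2 : ℝ) • B9SectDFP.piOp C Δ Q a D) *
          (K + D * B9H163.R Δ Q a * Dᵀ + ab • (Qbᵀ * Qb))⁻¹ ∧
    ((B9Eq3152.G1inv K C Δ Q a D Qb ab)⁻¹).PosDef ∧ (B9Eq3152.G1inv K C Δ Q a D Qb ab).PosDef := by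
  have hTp : ((K - B9SectDFP.piOp K Δ Q a D) + (2 : ℝ) • B9SectDFP.piOp C Δ Q a D)ᵀ =
      (K - B9SectDFP.piOp K Δ Q a D) + (2 : ℝ) • B9SectDFP.piOp C Δ Q a D := by
    rw [Matrix.transpose_add, Matrix.transpose_sub, Matrix.transpose_smul, hK, piOp_transpose K hK, piOp_transpose C hC]
  exact thm312_G1_core K C Δ Q a D Qb ab hΔa (expansion_posDef _ _ hΔa.inv hTp hρ hrow)

/-- **THE SAME FROM THE LEFT LETTER** — row sums of `|G₀(Δ′_π + Δ⁽²⁾_π)|` ≤ ρ < 1, the derivatives of `Δ′_π`, `Δ⁽²⁾_π` absorbed into `G₀` as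
in print's p. 423 estimates (r06 FILE 78's factored `G₀Δ⁽²⁾_π = 𝒢∘𝒯₂`): the same five conclusions, via the similarity `T′G₀ ~ G₀T′`.
[cite: Balaban1985BackgroundPropagators, Thm 3.12 p.423, (3.138) p.423, Thm 3.11 p.416] -/
theorem thm312_posDef_G1_left (K C : Matrix b b ℝ) (hK : Kᵀ = K) (hC : Cᵀ = C) (Δ : Matrix n n ℝ) (Q : Matrix m n ℝ) (a : ℝ)
    (D : Matrix b n ℝ) (Qb : Matrix q b ℝ) (ab : ℝ)
    (hΔa : (K + D * B9H163.R Δ Q a * Dᵀ + ab • (Qbᵀ * Qb)).PosDef) {ρ : ℝ} (hρ : ρ < 1)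
    (hrow : ∀ i, ∑ j, |((K + D * B9H163.R Δ Q a * Dᵀ + ab • (Qbᵀ * Qb))⁻¹ *
      ((K - B9SectDFP.piOp K Δ Q a D) + (2 : ℝ) • B9SectDFP.piOp C Δ Q a D)) i j| ≤ ρ) :
    IsUnit (B9Eq3152.G1inv K C Δ Q a D Qb ab).det ∧
    (B9Eq3152.G1inv K C Δ Q a D Qb ab)⁻¹ =
      (K + D * B9H163.R Δ Q a * Dᵀ + ab • (Qbᵀ * Qb))⁻¹ *
        (1 - ((K - B9SectDFP.piOp K Δ Q a D) + (2 : ℝ) • B9SectDFP.piOp C Δ Q a D) *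
          (K + D * B9H163.R Δ Q a * Dᵀ + ab • (Qbᵀ * Qb))⁻¹)⁻¹ ∧
    (B9Eq3152.G1inv K C Δ Q a D Qb ab)⁻¹ =
      (K + D * B9H163.R Δ Q a * Dᵀ + ab • (Qbᵀ * Qb))⁻¹ +
        (B9Eq3152.G1inv K C Δ Q a D Qb ab)⁻¹ * ((K - B9SectDFP.piOp K Δ Q a D) + (2 : ℝ) • B9SectDFP.piOp C Δ Q a D) *
          (K + D * B9H163.R Δ Q a * Dᵀ + ab • (Qbᵀ * Qb))⁻¹ ∧
    ((B9Eq3152.G1inv K C Δ Q a D Qb ab)⁻¹).PosDef ∧ (B9Eq3152.G1inv K C Δ Q a D Qb ab).PosDef := by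
  have hTp : ((K - B9SectDFP.piOp K Δ Q a D) + (2 : ℝ) • B9SectDFP.piOp C Δ Q a D)ᵀ =
      (K - B9SectDFP.piOp K Δ Q a D) + (2 : ℝ) • B9SectDFP.piOp C Δ Q a D := by
    rw [Matrix.transpose_add, Matrix.transpose_sub, Matrix.transpose_smul, hK, piOp_transpose K hK, piOp_transpose C hC]
  exact thm312_G1_core K C Δ Q a D Qb ab hΔa (expansion_posDef_left _ _ hΔa.inv hTp hρ hrow)

/-- **THEOREM 3.12, THE CLAUSE «THEOREM 3.11 HOLDS FOR G», BY (3.130)**: `G₀⁻¹ = K + DRD* + aQ_bᵀQ_b > 0`, `T′ := Δ′_π = K − TᵀKT` with row sums of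
`|Δ′_πG₀|` ≤ ρ < 1 ⟹ `G⁻¹ = Ginv K …` of (3.122) is invertible, `G = G₀(I − Δ′_πG₀)⁻¹` ((3.130)), `G = G₀ + GΔ′_πG₀`, `G > 0`, `G⁻¹ > 0`.
[cite: Balaban1985BackgroundPropagators, Thm 3.12 p.423, (3.130) p.421, Thm 3.11 p.416, (3.122) p.420] -/
theorem thm312_posDef_G (K : Matrix b b ℝ) (hK : Kᵀ = K) (Δ : Matrix n n ℝ) (Q : Matrix m n ℝ) (a : ℝ) (D : Matrix b n ℝ)
    (Qb : Matrix q b ℝ) (ab : ℝ) (hΔa : (K + D * B9H163.R Δ Q a * Dᵀ + ab • (Qbᵀ * Qb)).PosDef) {ρ : ℝ} (hρ : ρ < 1)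
    (hrow : ∀ i, ∑ j, |((K - B9SectDFP.piOp K Δ Q a D) * (K + D * B9H163.R Δ Q a * Dᵀ + ab • (Qbᵀ * Qb))⁻¹) i j| ≤ ρ) :
    IsUnit (B9SectDFP.Ginv K Δ Q a D Qb ab).det ∧
    (B9SectDFP.Ginv K Δ Q a D Qb ab)⁻¹ =
      (K + D * B9H163.R Δ Q a * Dᵀ + ab • (Qbᵀ * Qb))⁻¹ *
        (1 - (K - B9SectDFP.piOp K Δ Q a D) * (K + D * B9H163.R Δ Q a * Dᵀ + ab • (Qbᵀ * Qb))⁻¹)⁻¹ ∧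
    (B9SectDFP.Ginv K Δ Q a D Qb ab)⁻¹ =
      (K + D * B9H163.R Δ Q a * Dᵀ + ab • (Qbᵀ * Qb))⁻¹ +
        (B9SectDFP.Ginv K Δ Q a D Qb ab)⁻¹ * (K - B9SectDFP.piOp K Δ Q a D) *
          (K + D * B9H163.R Δ Q a * Dᵀ + ab • (Qbᵀ * Qb))⁻¹ ∧
    ((B9SectDFP.Ginv K Δ Q a D Qb ab)⁻¹).PosDef ∧ (B9SectDFP.Ginv K Δ Q a D Qb ab).PosDef := by
  set G0inv : Matrix b b ℝ := K + D * B9H163.R Δ Q a * Dᵀ + ab • (Qbᵀ * Qb) with hG0inv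
  set Tp : Matrix b b ℝ := K - B9SectDFP.piOp K Δ Q a D with hTpdef
  have hG0idet : IsUnit G0inv.det := (Matrix.isUnit_iff_isUnit_det _).mp hΔa.isUnit
  have hG0 : (G0inv⁻¹).PosDef := hΔa.inv
  have hTp : Tpᵀ = Tp := by rw [hTpdef, Matrix.transpose_sub, hK, piOp_transpose K hK]
  obtain ⟨-, hres, hleft, -, -, hpos⟩ := expansion_posDef G0inv⁻¹ Tp hG0 hTp hρ hrow
  have hM : G0inv⁻¹⁻¹ - Tp = B9SectDFP.Ginv K Δ Q a D Qb ab := by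
    rw [Matrix.nonsing_inv_nonsing_inv _ hG0idet, hG0inv, hTpdef]
    exact G0inv_sub_eq_Ginv K Δ Q a D Qb ab
  rw [hM] at hleft
  have hdet : IsUnit (B9SectDFP.Ginv K Δ Q a D Qb ab).det := Matrix.isUnit_det_of_right_inverse hleft
  have hinv : (B9SectDFP.Ginv K Δ Q a D Qb ab)⁻¹ = G0inv⁻¹ * (1 - Tp * G0inv⁻¹)⁻¹ := Matrix.inv_eq_right_inv hleft
  refine ⟨hdet, hinv, ?_, ?_, ?_⟩
  · rw [hinv]; exact hres
  · rw [hinv]; exact hpos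
  · have h := (hinv ▸ hpos : ((B9SectDFP.Ginv K Δ Q a D Qb ab)⁻¹).PosDef).inv
    rwa [Matrix.nonsing_inv_nonsing_inv _ hdet] at h

end SectD

/-! ## §4 Feeding the smallness letter: row sums of products, of `ℓ^∞`-bounded operators, and of [5]'s concrete `Δ⁽²⁾` -/

section RowSums

variable {X Y Z : Type*} [Fintype Y] [Fintype Z]

/-- row sums of `|AB|` ≤ (max row sum of `|A|`)·(max row sum of `|B|`) — the sup-norm submultiplicativity behind «the series (3.138) is
convergent for α₀ restricted by a small, absolute constant» (the letter for `(Δ′_π + Δ⁽²⁾_π)G₀` from letters for the two factors).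
[cite: Balaban1985BackgroundPropagators, (3.138) p.423] [cite: Balaban1984PropagatorsII, (2.52)–(2.55) p.232] -/
theorem rowSums_mul_le (A : Matrix X Y ℝ) (B : Matrix Y Z ℝ) {α β : ℝ} (hβ : 0 ≤ β) (hA : ∀ i, ∑ k, |A i k| ≤ α)
    (hB : ∀ k, ∑ j, |B k j| ≤ β) (i : X) : ∑ j, |(A * B) i j| ≤ α * β := by
  calc ∑ j, |(A * B) i j| = ∑ j, |∑ k, A i k * B k j| := by simp only [Matrix.mul_apply]
    _ ≤ ∑ j, ∑ k, |A i k| * |B k j| :=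
        Finset.sum_le_sum fun j _ => (Finset.abs_sum_le_sum_abs _ _).trans (le_of_eq (Finset.sum_congr rfl fun k _ => abs_mul _ _))
    _ = ∑ k, |A i k| * ∑ j, |B k j| := by rw [Finset.sum_comm]; simp only [Finset.mul_sum]
    _ ≤ ∑ k, |A i k| * β := Finset.sum_le_sum fun k _ => mul_le_mul_of_nonneg_left (hB k) (abs_nonneg _)
    _ = (∑ k, |A i k|) * β := (Finset.sum_mul _ _ _).symm
    _ ≤ α * β := mul_le_mul_of_nonneg_right (hA i) hβ

/-- an `ℓ^∞ → ℓ^∞` bound `‖Mx‖_∞ ≤ θ‖x‖_∞` IS a row-sum bound `Σ_j |M(i,j)| ≤ θ` (test on the sign vector of row `i`) — «Δ⁽²⁾, Δ⁽²⁾_π are small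
in a proper sense» read as the sup-letter of the expansion (3.138). [cite: Balaban1985BackgroundPropagators, (3.137)–(3.138) p.423] -/
theorem rowSum_le_of_mulVec_le [Fintype X] (M : Matrix X Y ℝ) {θ : ℝ} (hθ : 0 ≤ θ)
    (hM : ∀ x : Y → ℝ, ‖M *ᵥ x‖ ≤ θ * ‖x‖) (i : X) : ∑ j, |M i j| ≤ θ := by
  classical
  set x : Y → ℝ := fun j => if 0 ≤ M i j then 1 else -1 with hx
  have hxn : ‖x‖ ≤ 1 := by
    refine (pi_norm_le_iff_of_nonneg zero_le_one).2 fun j => ?_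
    simp only [hx]
    split_ifs <;> simp
  have hrow : (M *ᵥ x) i = ∑ j, |M i j| := by
    simp only [Matrix.mulVec, dotProduct, hx]
    refine Finset.sum_congr rfl fun j _ => ?_
    split_ifs with h
    · rw [mul_one, abs_of_nonneg h]
    · rw [mul_neg, mul_one, abs_of_neg (lt_of_not_ge h)]
  calc ∑ j, |M i j| = (M *ᵥ x) i := hrow.symm
    _ ≤ |(M *ᵥ x) i| := le_abs_self _
    _ = ‖(M *ᵥ x) i‖ := (Real.norm_eq_abs _).symm
    _ ≤ ‖M *ᵥ x‖ := norm_le_pi_norm _ i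
    _ ≤ θ * ‖x‖ := hM x
    _ ≤ θ * 1 := mul_le_mul_of_nonneg_left hxn hθ
    _ = θ := mul_one θ

end RowSums

section Concrete

open NormedSpace Finset Metric Filter
open B7Prop1Explicit B7Prop1Local B7Prop2Explicit B7Prop3Flat B7Prop4Flat B7Eq92Concrete B7Prop3GeneralLinear
  B7Prop4GeneralLevels B7Prop5GeneralOperators B7Prop5GeneralInduction B7Prop5GeneralLevels B7Ineq149Pairing B7Eq136SecondOrder
  B9Ineq3137From149 B9Eq3134MatrixConcrete

variable {d : ℕ}
variable {𝔸 : Type*} [NormedRing 𝔸] [NormedAlgebra ℂ 𝔸] [CompleteSpace 𝔸] [NormOneClass 𝔸]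

variable (L : ℕ) (hL : 2 ≤ L) {G : Subgroup 𝔸ˣ} (hG : AvgClosed d L G) (k : ℕ)
  (U₀ : B7Prop1Explicit.Site d → Fin d → 𝔸ˣ) (hU₀ : ∀ x κ, U₀ x κ ∈ G) {α₀ : ℝ} (hα : 0 < α₀)
  (hα3 : C0 d * α₀ ≤ 1 / 3) (hα4 : 4 * α₀ ≤ c2' d L) (h52 : pdev U₀ < α₀ * (((L : ℝ) ^ k)⁻¹) ^ 2)
  {b : ℝ} (hb : 0 < b)
  (hsmall : Real.exp (4 * (800 * ((d : ℝ) + 1) ^ 2 * ((d : ℝ) + 4)) * α₀)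
    * (1 + 8 * (131072 * ((d : ℝ) + 1) ^ 2) * ((L : ℝ) ^ k * b)) ≤ 2)
  (hc₃ : 4 * ((L : ℝ) ^ k * b) < c3 d L)
  (h145 : 8 * d * thetaGen d L α₀ * (L : ℝ)⁻¹ ^ 4 ≤ 1)
  (h155 : (2 * (L : ℝ) - 1) * (L : ℝ)⁻¹ ^ 2 + 2 * d * thetaGen d L α₀ * (L : ℝ)⁻¹ ^ 3
    + 1 / 8 * (1 + 2 * d * thetaGen d L α₀ * (L : ℝ)⁻¹ ^ 2 + 2 * d * C3Gen d L * ((L : ℝ) ^ k * b)) * (L : ℝ)⁻¹ ^ 2 ≤ 1)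
  (S : Finset (B7Prop1Explicit.Site d × Fin d))
  (lv : Finset ℕ) (T : ℕ → Finset (B7Prop1Explicit.Site d × Fin d)) (w : ℕ → B7Prop1Explicit.Site d × Fin d → ℝ)
  (K : ℕ → B7Prop1Explicit.Site d × Fin d → 𝔸)

variable {ι : Type*} [Fintype ι] (e : ι → 𝔸) (τ : 𝔸 →L[ℝ] ℝ)

include hL hG hU₀ hα hα3 hα4 h52 hb hsmall hc₃ h145 h155 in
/-- **«Δ⁽²⁾ … SMALL IN A PROPER SENSE» AS A ROW-SUM LETTER** for [5]'s realised second-order form (FILE 74's `delta2 (calC …)` on the real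
coordinates `S × ι → ℝ`): `Σ_j |Δ⁽²⁾(i,j)| ≤ [2dC₃‖τ‖(Σ_i‖e_i‖)M_e c₀·#lv]·(Mα₀)` — FILE 74 `norm_delta2_calC_mulVec_le` BY NAME + `rowSum_le_of_mulVec_le`.
[cite: Balaban1985BackgroundPropagators, (3.137) p.423, Thm 3.12 p.423] [cite: Balaban1985Averaging, (149) p.40] -/
theorem rowSums_delta2_calC_le (hd : 2 ≤ d) (hJ : ∀ j ∈ lv, j ≤ k) (hw : ∀ j ∈ lv, ∀ c ∈ T j, 0 ≤ w j c)
    {c₀ M Me : ℝ} (hc₀ : 0 ≤ c₀ * M) (hM : 0 ≤ M) (he : ∀ i, ‖e i‖ ≤ Me)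
    (hK : ∀ j ∈ lv, ∀ c ∈ T j, w j c * ‖K j c‖ ≤ c₀ * M * α₀ * ((L : ℝ) ^ j) ^ (d - 2)) (p : S × ι) :
    ∑ p', |B9Delta2Def134.delta2 (calC L U₀ S lv T w K e τ) p p'| ≤
      (2 * d * C3Gen d L * ‖τ‖ * (∑ i, ‖e i‖) * Me * c₀ * lv.card) * (M * α₀) := by
  rcases isEmpty_or_nonempty ι with hι | ⟨⟨i₀⟩⟩
  · exact (IsEmpty.false p.2).elim
  have hMe : 0 ≤ Me := (norm_nonneg _).trans (he i₀)
  have hc₀' : 0 ≤ c₀ ∨ M = 0 := by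
    rcases lt_or_eq_of_le hM with hM' | hM'
    · exact Or.inl (nonneg_of_mul_nonneg_left hc₀ hM')
    · exact Or.inr hM'.symm
  have hθ : 0 ≤ (2 * d * C3Gen d L * ‖τ‖ * (∑ i, ‖e i‖) * Me * c₀ * lv.card) * (M * α₀) := by
    have hC := C3Gen_nonneg d L
    have hE : 0 ≤ ∑ i, ‖e i‖ := Finset.sum_nonneg fun i _ => norm_nonneg _
    have h1 : (2 * d * C3Gen d L * ‖τ‖ * (∑ i, ‖e i‖) * Me * c₀ * lv.card) * (M * α₀) =
        2 * d * C3Gen d L * ‖τ‖ * (∑ i, ‖e i‖) * Me * lv.card * ((c₀ * M) * α₀) := by ring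
    rw [h1]
    exact mul_nonneg (by positivity) (mul_nonneg hc₀ hα.le)
  exact rowSum_le_of_mulVec_le _ hθ
    (fun x => norm_delta2_calC_mulVec_le L hL hG k U₀ hU₀ hα hα3 hα4 h52 hb hsmall hc₃ h145 h155 S lv T w K e τ hd hJ hw hc₀ he
      hK x) p

end Concrete

/-! ## §5 Companion (form route): `K − 2𝒞 + DRD* + aQ_bᵀQ_b > 0` from `Δ_a > 0` and a form-smallness of `2𝒞` — the input of the B09
lineage's `B9Eq3152.G1inv_posDef_of_Δa` -/

section FormRoute

variable {X : Type*} [Fintype X]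

/-- `P > 0`, `C` symmetric and `⟨x,Cx⟩ < ⟨x,Px⟩` for `x ≠ 0` ⟹ `P − C > 0` — the quadratic-form reading of «Δ⁽²⁾, Δ⁽²⁾_π are small in a
proper sense» against `Δ_a`. [cite: Balaban1985BackgroundPropagators, (3.137) p.423, (3.128) p.421] -/
theorem posDef_sub_of_form_lt (P C : Matrix X X ℝ) (hP : P.PosDef) (hC : Cᵀ = C)
    (hsmall : ∀ x : X → ℝ, x ≠ 0 → x ⬝ᵥ (C *ᵥ x) < x ⬝ᵥ (P *ᵥ x)) : (P - C).PosDef := by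
  refine Matrix.PosDef.of_dotProduct_mulVec_pos ?_ fun x hx => ?_
  · exact isHermitian_of_transpose_eq (by rw [Matrix.transpose_sub, transpose_eq_of_posDef hP, hC])
  · rw [star_trivial, Matrix.sub_mulVec, dotProduct_sub]
    exact sub_pos.mpr (hsmall x hx)

end FormRoute

section FormRouteSectD

variable {n m b q : Type*} [Fintype n] [Fintype m] [Fintype b] [Fintype q] [DecidableEq n] [DecidableEq m] [DecidableEq b]

/-- **THE FORM ROUTE TO «THEOREM 3.11 HOLDS FOR G₁»** (companion of `thm312_posDef_G1`, feeding pub-balaban's `B9Eq3152.G1inv_posDef_of_Δa`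
BY NAME): Theorem 3.11's `Δ_a`-input `K + DRD* + aQ_bᵀQ_b > 0` and the form-smallness `⟨A, 2𝒞A⟩ < ⟨A, (K + DRD* + aQ_bᵀQ_b)A⟩` (`A ≠ 0`) give
`K − 2𝒞 + DRD* + aQ_bᵀQ_b > 0`, hence `G₁⁻¹ = G1inv K 𝒞 … > 0` and `G₁ > 0` ((3.128): `⟨A,G₁⁻¹A⟩ = ⟨TA,(K − 2𝒞)TA⟩ + ‖RD*A‖² + a‖Q_bA‖²`).
[cite: Balaban1985BackgroundPropagators, Thm 3.12 p.423, (3.128) p.421, Thm 3.11 p.416] -/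
theorem G1inv_posDef_of_form_small (K C : Matrix b b ℝ) (hK : Kᵀ = K) (hC : Cᵀ = C) (Δ : Matrix n n ℝ) (Q : Matrix m n ℝ) (a : ℝ)
    (hΔ : Δ.IsSymm) (hΔ' : IsUnit (B9H163.Δ' Δ Q a)) (hM' : IsUnit (B9H163.M' Δ Q a)) (D : Matrix b n ℝ) (hD : Dᵀ * D = Δ)
    (Qb : Matrix q b ℝ) (Dbar : Matrix q m ℝ) (h115 : Qb * D = Dbar * Q) (ab : ℝ)
    (hΔa : (K + D * B9H163.R Δ Q a * Dᵀ + ab • (Qbᵀ * Qb)).PosDef)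
    (hsmall : ∀ A : b → ℝ, A ≠ 0 → A ⬝ᵥ (((2 : ℝ) • C) *ᵥ A) < A ⬝ᵥ ((K + D * B9H163.R Δ Q a * Dᵀ + ab • (Qbᵀ * Qb)) *ᵥ A)) :
    (K - (2 : ℝ) • C + D * B9H163.R Δ Q a * Dᵀ + ab • (Qbᵀ * Qb)).PosDef ∧
    (B9Eq3152.G1inv K C Δ Q a D Qb ab).PosDef ∧ ((B9Eq3152.G1inv K C Δ Q a D Qb ab)⁻¹).PosDef := by
  have h2C : ((2 : ℝ) • C)ᵀ = (2 : ℝ) • C := by rw [Matrix.transpose_smul, hC]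
  have hP := posDef_sub_of_form_lt _ _ hΔa h2C hsmall
  have hEq : K + D * B9H163.R Δ Q a * Dᵀ + ab • (Qbᵀ * Qb) - (2 : ℝ) • C = K - (2 : ℝ) • C + D * B9H163.R Δ Q a * Dᵀ + ab • (Qbᵀ * Qb) := by
    abel
  rw [hEq] at hP
  have hG1 := B9Eq3152.G1inv_posDef_of_Δa K C hK hC Δ Q a hΔ hΔ' hM' D hD Qb Dbar h115 ab hP
  exact ⟨hP, hG1, hG1.inv⟩

end FormRouteSectD

/-! ## §6 The form SANDWICH at p10's level — pub-balaban r1's `B9SectDForm.G1_sandwich` (the (N′) route) instantiated for `G₁⁻¹ = G1inv` -/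

section Sandwich

variable {n m b q : Type*} [Fintype n] [Fintype m] [Fintype b] [Fintype q] [DecidableEq n] [DecidableEq m] [DecidableEq b]

/-- **THEOREM 3.12's POSITIVITY CLAUSE WITH THE FORM SANDWICH** (pub-balaban r1's `B9SectDForm.G1_sandwich` BY NAME — the relative form bound
(N′) `|⟨A,(Δ′_π + Δ⁽²⁾_π)A⟩| ≤ r⟨A,Δ_aA⟩`, `r < 1`, the bilinear shape in which (3.131)/(3.137) are printed): `Δ_a = K + DRD* + aQ_bᵀQ_b` coercive
(`γ > 0`; Theorem 3.11), `K`, `𝒞`, `Δ` symmetric ⟹ `G₁⁻¹ = G1inv K 𝒞 …` ((3.128); `= Δ_a − (Δ′_π + Δ⁽²⁾_π)` by `G0inv_sub_eq_G1inv`) is coercive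
with `(1 − r)γ` — in particular positive — and `(1 + r)⁻¹⟨x,G₀x⟩ ≤ ⟨x,G₁x⟩ ≤ (1 − r)⁻¹⟨x,G₀x⟩`.
[cite: Balaban1985BackgroundPropagators, Thm 3.12 p.423, (3.138) p.423, (3.131) p.422, (3.137) p.423, Thm 3.11 p.416] -/
theorem thm312_G1_sandwich (K C : Matrix b b ℝ) (hK : Kᵀ = K) (hC : Cᵀ = C) (Δ : Matrix n n ℝ) (Q : Matrix m n ℝ) (a : ℝ)
    (hΔ : Δ.IsSymm) (D : Matrix b n ℝ) (Qb : Matrix q b ℝ) (ab : ℝ) {γ r : ℝ} (hγ : 0 < γ)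
    (hSc : QGQInverse.Coercive (K + D * B9H163.R Δ Q a * Dᵀ + ab • (Qbᵀ * Qb)) γ) (hr : 0 ≤ r) (hr1 : r < 1)
    (hTr : ∀ A : b → ℝ, |A ⬝ᵥ (((K - B9SectDFP.piOp K Δ Q a D) + (2 : ℝ) • B9SectDFP.piOp C Δ Q a D) *ᵥ A)| ≤
      r * (A ⬝ᵥ ((K + D * B9H163.R Δ Q a * Dᵀ + ab • (Qbᵀ * Qb)) *ᵥ A))) :
    QGQInverse.Coercive (B9Eq3152.G1inv K C Δ Q a D Qb ab) ((1 - r) * γ) ∧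
    (∀ x : b → ℝ, (1 + r)⁻¹ * (x ⬝ᵥ ((K + D * B9H163.R Δ Q a * Dᵀ + ab • (Qbᵀ * Qb))⁻¹ *ᵥ x)) ≤
      x ⬝ᵥ ((B9Eq3152.G1inv K C Δ Q a D Qb ab)⁻¹ *ᵥ x)) ∧
    (∀ x : b → ℝ, x ⬝ᵥ ((B9Eq3152.G1inv K C Δ Q a D Qb ab)⁻¹ *ᵥ x) ≤
      (1 - r)⁻¹ * (x ⬝ᵥ ((K + D * B9H163.R Δ Q a * Dᵀ + ab • (Qbᵀ * Qb))⁻¹ *ᵥ x))) := by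
  have hS : (K + D * B9H163.R Δ Q a * Dᵀ + ab • (Qbᵀ * Qb)).IsSymm := by
    unfold Matrix.IsSymm
    rw [Matrix.transpose_add, Matrix.transpose_add, hK, Matrix.transpose_mul, Matrix.transpose_mul, Matrix.transpose_transpose,
      B9SectECov.R_transpose Δ Q a hΔ, ← Matrix.mul_assoc, Matrix.transpose_smul, Matrix.transpose_mul, Matrix.transpose_transpose]
  have hT : ((K - B9SectDFP.piOp K Δ Q a D) + (2 : ℝ) • B9SectDFP.piOp C Δ Q a D).IsSymm := by
    unfold Matrix.IsSymm
    rw [Matrix.transpose_add, Matrix.transpose_sub, Matrix.transpose_smul, hK, piOp_transpose K hK, piOp_transpose C hC]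
  have h := B9SectDForm.G1_sandwich _ _ hS hγ hSc hT hr hr1 hTr
  rw [G0inv_sub_eq_G1inv] at h
  exact h

end Sandwich

/-! ## §7 The SERIES (3.138) at p10's matrix level in the sup operator norm — r06 FILE 68 `B9Eq3130Neumann.eq3138_hasSum` instantiated -/

section Series

open scoped Matrix.Norms.Operator NNReal

variable {n m b q : Type*} [Fintype n] [Fintype m] [Fintype b] [Fintype q] [DecidableEq n] [DecidableEq m] [DecidableEq b]

/-- row sums of `|R|` ≤ ρ IS `‖R‖ ≤ ρ` in the sup operator norm `‖R‖_{∞→∞} = sup_i Σ_j |R(i,j)|` (Mathlib's `Matrix.linftyOpNormedRing`) — the norm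
of «the series (3.138) is convergent» read at the sup level. [cite: Balaban1985BackgroundPropagators, (3.138) p.423]
[cite: Balaban1984PropagatorsII, (2.52)–(2.55) p.232] -/
theorem linfty_opNorm_le_of_rowSums (R : Matrix b b ℝ) {ρ : ℝ} (hρ : 0 ≤ ρ) (hrow : ∀ i, ∑ j, |R i j| ≤ ρ) : ‖R‖ ≤ ρ := by
  rw [Matrix.linfty_opNorm_def]
  have h : ∀ i, (∑ j, ‖R i j‖₊ : ℝ≥0) ≤ Real.toNNReal ρ := fun i => by
    rw [← NNReal.coe_le_coe, NNReal.coe_sum, Real.coe_toNNReal _ hρ]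
    simpa [Real.norm_eq_abs] using hrow i
  calc (((Finset.univ : Finset b).sup fun i : b => ∑ j : b, ‖R i j‖₊ : ℝ≥0) : ℝ) ≤ (Real.toNNReal ρ : ℝ) :=
        NNReal.coe_le_coe.mpr (Finset.sup_le fun i _ => h i)
    _ = ρ := Real.coe_toNNReal _ hρ

/-- **(3.138), SECOND MEMBER, AT p10's MATRIX LEVEL**: with `G₀ = (K + DRD* + aQ_bᵀQ_b)⁻¹` (`Δ_a` invertible) and row sums of
`|(Δ′_π + Δ⁽²⁾_π)G₀|` ≤ ρ < 1, the series `Σ_n G₀((Δ′_π + Δ⁽²⁾_π)G₀)ⁿ` converges in the sup operator norm to `G₁ = (G1inv K 𝒞 …)⁻¹` — r06 FILE 68's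
normed-ring statement `B9Eq3130Neumann.eq3138_hasSum` at the letters `Δ := K`, `DRD* := DRDᵀ`, `Q*aQ := a·Q_bᵀQ_b`, `Δ′_π := K − TᵀKT`,
`Δ⁽²⁾_π := 2Tᵀ𝒞T` (its target `(Δ + DRD* + Q*aQ) − (Δ′_π + Δ⁽²⁾_π)` IS `G1inv` by `G0inv_sub_eq_G1inv`), and with Theorem 3.11 for `Δ_a` and `K`, `𝒞`
symmetric that sum is POSITIVE DEFINITE (`thm312_posDef_G1`). [cite: Balaban1985BackgroundPropagators, (3.138) p.423, Thm 3.12 p.423] -/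
theorem eq3138_hasSum_posDef (K C : Matrix b b ℝ) (hK : Kᵀ = K) (hC : Cᵀ = C) (Δ : Matrix n n ℝ) (Q : Matrix m n ℝ) (a : ℝ)
    (D : Matrix b n ℝ) (Qb : Matrix q b ℝ) (ab : ℝ)
    (hΔa : (K + D * B9H163.R Δ Q a * Dᵀ + ab • (Qbᵀ * Qb)).PosDef) {ρ : ℝ} (hρ0 : 0 ≤ ρ) (hρ : ρ < 1)
    (hrow : ∀ i, ∑ j, |(((K - B9SectDFP.piOp K Δ Q a D) + (2 : ℝ) • B9SectDFP.piOp C Δ Q a D) *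
      (K + D * B9H163.R Δ Q a * Dᵀ + ab • (Qbᵀ * Qb))⁻¹) i j| ≤ ρ) :
    HasSum (fun n : ℕ => (K + D * B9H163.R Δ Q a * Dᵀ + ab • (Qbᵀ * Qb))⁻¹ *
        (((K - B9SectDFP.piOp K Δ Q a D) + (2 : ℝ) • B9SectDFP.piOp C Δ Q a D) * (K + D * B9H163.R Δ Q a * Dᵀ + ab • (Qbᵀ * Qb))⁻¹) ^ n)
      (B9Eq3152.G1inv K C Δ Q a D Qb ab)⁻¹ ∧
    ((B9Eq3152.G1inv K C Δ Q a D Qb ab)⁻¹).PosDef := by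
  set G0inv : Matrix b b ℝ := K + D * B9H163.R Δ Q a * Dᵀ + ab • (Qbᵀ * Qb) with hG0inv
  have hG0idet : IsUnit G0inv.det := (Matrix.isUnit_iff_isUnit_det _).mp hΔa.isUnit
  have h₁ : (K + D * B9H163.R Δ Q a * Dᵀ + ab • (Qbᵀ * Qb)) * G0inv⁻¹ = 1 := Matrix.mul_nonsing_inv _ hG0idet
  have h₂ : G0inv⁻¹ * (K + D * B9H163.R Δ Q a * Dᵀ + ab • (Qbᵀ * Qb)) = 1 := Matrix.nonsing_inv_mul _ hG0idet
  have hn : ‖((K - B9SectDFP.piOp K Δ Q a D) + (2 : ℝ) • B9SectDFP.piOp C Δ Q a D) * G0inv⁻¹‖ < 1 :=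
    (linfty_opNorm_le_of_rowSums _ hρ0 hrow).trans_lt hρ
  have key := B9Eq3130Neumann.eq3138_hasSum K (D * B9H163.R Δ Q a * Dᵀ) (ab • (Qbᵀ * Qb)) (K - B9SectDFP.piOp K Δ Q a D)
    ((2 : ℝ) • B9SectDFP.piOp C Δ Q a D) G0inv⁻¹ h₁ h₂ hn
  rw [G0inv_sub_eq_G1inv, ← Matrix.nonsing_inv_eq_ringInverse] at key
  exact ⟨key, (thm312_posDef_G1 K C hK hC Δ Q a D Qb ab hΔa hρ hrow).2.2.2.1⟩

/-- **(3.130), SECOND MEMBER, AT p10's MATRIX LEVEL** (the twin for `G` of (3.122)): with row sums of `|Δ′_πG₀|` ≤ ρ < 1 the series `Σ_n G₀(Δ′_πG₀)ⁿ`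
converges in the sup operator norm to `G = (Ginv K …)⁻¹`, positive definite — r06 FILE 68's `B9Eq3130Neumann.eq3130_hasSum` at the letters
`Δ := K`, `Δ′_π := K − TᵀKT` (target `= Ginv K …` by `G0inv_sub_eq_Ginv`) + `thm312_posDef_G`.
[cite: Balaban1985BackgroundPropagators, (3.130) p.421, Thm 3.12 p.423] -/
theorem eq3130_hasSum_posDef (K : Matrix b b ℝ) (hK : Kᵀ = K) (Δ : Matrix n n ℝ) (Q : Matrix m n ℝ) (a : ℝ) (D : Matrix b n ℝ)
    (Qb : Matrix q b ℝ) (ab : ℝ) (hΔa : (K + D * B9H163.R Δ Q a * Dᵀ + ab • (Qbᵀ * Qb)).PosDef) {ρ : ℝ} (hρ0 : 0 ≤ ρ) (hρ : ρ < 1)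
    (hrow : ∀ i, ∑ j, |((K - B9SectDFP.piOp K Δ Q a D) * (K + D * B9H163.R Δ Q a * Dᵀ + ab • (Qbᵀ * Qb))⁻¹) i j| ≤ ρ) :
    HasSum (fun n : ℕ => (K + D * B9H163.R Δ Q a * Dᵀ + ab • (Qbᵀ * Qb))⁻¹ *
        ((K - B9SectDFP.piOp K Δ Q a D) * (K + D * B9H163.R Δ Q a * Dᵀ + ab • (Qbᵀ * Qb))⁻¹) ^ n)
      (B9SectDFP.Ginv K Δ Q a D Qb ab)⁻¹ ∧
    ((B9SectDFP.Ginv K Δ Q a D Qb ab)⁻¹).PosDef := by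
  set G0inv : Matrix b b ℝ := K + D * B9H163.R Δ Q a * Dᵀ + ab • (Qbᵀ * Qb) with hG0inv
  have hG0idet : IsUnit G0inv.det := (Matrix.isUnit_iff_isUnit_det _).mp hΔa.isUnit
  have h₁ : (K + D * B9H163.R Δ Q a * Dᵀ + ab • (Qbᵀ * Qb)) * G0inv⁻¹ = 1 := Matrix.mul_nonsing_inv _ hG0idet
  have h₂ : G0inv⁻¹ * (K + D * B9H163.R Δ Q a * Dᵀ + ab • (Qbᵀ * Qb)) = 1 := Matrix.nonsing_inv_mul _ hG0idet
  have hn : ‖(K - B9SectDFP.piOp K Δ Q a D) * G0inv⁻¹‖ < 1 := (linfty_opNorm_le_of_rowSums _ hρ0 hrow).trans_lt hρ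
  have key := B9Eq3130Neumann.eq3130_hasSum K (D * B9H163.R Δ Q a * Dᵀ) (ab • (Qbᵀ * Qb)) (K - B9SectDFP.piOp K Δ Q a D) G0inv⁻¹
    h₁ h₂ hn
  rw [G0inv_sub_eq_Ginv, ← Matrix.nonsing_inv_eq_ringInverse] at key
  exact ⟨key, (thm312_posDef_G K hK Δ Q a D Qb ab hΔa hρ hrow).2.2.2.1⟩

/-- **(3.138), SECOND MEMBER, FROM THE LEFT LETTER**: row sums of `|G₀(Δ′_π + Δ⁽²⁾_π)|` ≤ ρ < 1 (derivatives absorbed into `G₀`, the printed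
estimates) ⟹ `Σ_n G₀((Δ′_π + Δ⁽²⁾_π)G₀)ⁿ = Σ_n (G₀(Δ′_π + Δ⁽²⁾_π))ⁿG₀` (pub-balaban r1 `B9SectDForm.neumann_term_eq`) converges in the sup operator
norm to `(G1inv K 𝒞 …)⁻¹`, positive definite (Mathlib `hasSum_geom_series_inverse` + `thm312_posDef_G1_left`).
[cite: Balaban1985BackgroundPropagators, (3.138) p.423, Thm 3.12 p.423] -/
theorem eq3138_hasSum_posDef_left (K C : Matrix b b ℝ) (hK : Kᵀ = K) (hC : Cᵀ = C) (Δ : Matrix n n ℝ) (Q : Matrix m n ℝ) (a : ℝ)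
    (D : Matrix b n ℝ) (Qb : Matrix q b ℝ) (ab : ℝ)
    (hΔa : (K + D * B9H163.R Δ Q a * Dᵀ + ab • (Qbᵀ * Qb)).PosDef) {ρ : ℝ} (hρ0 : 0 ≤ ρ) (hρ : ρ < 1)
    (hrow : ∀ i, ∑ j, |((K + D * B9H163.R Δ Q a * Dᵀ + ab • (Qbᵀ * Qb))⁻¹ *
      ((K - B9SectDFP.piOp K Δ Q a D) + (2 : ℝ) • B9SectDFP.piOp C Δ Q a D)) i j| ≤ ρ) :
    HasSum (fun n : ℕ => (K + D * B9H163.R Δ Q a * Dᵀ + ab • (Qbᵀ * Qb))⁻¹ *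
        (((K - B9SectDFP.piOp K Δ Q a D) + (2 : ℝ) • B9SectDFP.piOp C Δ Q a D) * (K + D * B9H163.R Δ Q a * Dᵀ + ab • (Qbᵀ * Qb))⁻¹) ^ n)
      (B9Eq3152.G1inv K C Δ Q a D Qb ab)⁻¹ ∧
    ((B9Eq3152.G1inv K C Δ Q a D Qb ab)⁻¹).PosDef := by
  set G0inv : Matrix b b ℝ := K + D * B9H163.R Δ Q a * Dᵀ + ab • (Qbᵀ * Qb) with hG0inv
  set Tp : Matrix b b ℝ := (K - B9SectDFP.piOp K Δ Q a D) + (2 : ℝ) • B9SectDFP.piOp C Δ Q a D with hTpdef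
  have hG0idet : IsUnit G0inv.det := (Matrix.isUnit_iff_isUnit_det _).mp hΔa.isUnit
  obtain ⟨hdet, -, -, hpos, -⟩ := thm312_posDef_G1_left K C hK hC Δ Q a D Qb ab hΔa hρ hrow
  have hn : ‖G0inv⁻¹ * Tp‖ < 1 := (linfty_opNorm_le_of_rowSums _ hρ0 hrow).trans_lt hρ
  have hs := (hasSum_geom_series_inverse (G0inv⁻¹ * Tp) hn).mul_right G0inv⁻¹
  -- termwise `(G₀T′)ⁿG₀ = G₀(T′G₀)ⁿ`
  have hfun : (fun i : ℕ => (G0inv⁻¹ * Tp) ^ i * G0inv⁻¹) = fun n : ℕ => G0inv⁻¹ * (Tp * G0inv⁻¹) ^ n :=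
    funext fun i => (B9SectDForm.neumann_term_eq G0inv⁻¹ Tp i).symm
  -- value `(I − G₀T′)⁻¹G₀ = G₁`: `I − G₀T′ = G₀·G₁⁻¹`
  have hfac : 1 - G0inv⁻¹ * Tp = G0inv⁻¹ * B9Eq3152.G1inv K C Δ Q a D Qb ab := by
    rw [← G0inv_sub_eq_G1inv, ← hG0inv, ← hTpdef, Matrix.mul_sub, Matrix.nonsing_inv_mul _ hG0idet]
  have hval : Ring.inverse (1 - G0inv⁻¹ * Tp) * G0inv⁻¹ = (B9Eq3152.G1inv K C Δ Q a D Qb ab)⁻¹ := by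
    rw [← Matrix.nonsing_inv_eq_ringInverse, hfac, Matrix.mul_inv_rev, Matrix.nonsing_inv_nonsing_inv _ hG0idet, Matrix.mul_assoc,
      Matrix.mul_nonsing_inv _ hG0idet, Matrix.mul_one]
  rw [hfun, hval] at hs
  exact ⟨hs, hpos⟩

end Series

/-! ## §8 From a block majorant ([4] (2.51)–(2.55), r16's `B11SectG.HasMaj` on the sharp blocks) to the sup letter: row sums -/

section FromMajorant

variable {g : B6.Geometry} {X : Type} [Fintype X]

/-- **BLOCK MAJORANT ⟹ ROW-SUM LETTER**: if `M` has the block majorant `K` between the sharp-block sup norms (`‖Δ(y)MΔ(y′)μ‖_∞ ≤ K(y,y′)‖μ‖_∞`,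
[4] (2.51); the shape r06 FILE 78 / pub-balaban r1 `B9SectDSup` produce for `G₀(Δ′_π + Δ⁽²⁾_π)`), `K ≥ 0`, then `Σ_{x′} |M(x,x′)| ≤ Σ_{y′} K(y(x),y′)` —
with `K = C·e^{−δd}` and the row-sum (2.61) this is the sup letter `C·c` of §1–§3. [cite: Balaban1985BackgroundPropagators, (3.138) p.423]
[cite: Balaban1984PropagatorsII, (2.51)–(2.55) p.232, (2.61) p.234] -/
theorem rowSum_le_of_hasMaj_ofBlocks (blk : X → g.Site) (M : Matrix X X ℝ) {K : g.Site → g.Site → ℝ} (hK : ∀ y y', 0 ≤ K y y')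
    (hM : B11SectG.HasMaj (B11SectG.BlockNorm.ofBlocks g blk) (B11SectG.BlockNorm.ofBlocks g blk) (Matrix.mulVecLin M) K) (x : X) :
    ∑ x', |M x x'| ≤ ∑ y', K (blk x) y' := by
  classical
  -- split the row over the blocks
  have hsplit : ∑ x', |M x x'| = ∑ y', ∑ x', (if blk x' = y' then |M x x'| else 0) := by
    rw [Finset.sum_comm]
    refine Finset.sum_congr rfl fun x' _ => ?_
    rw [Finset.sum_ite_eq]
    simp
  rw [hsplit]
  refine Finset.sum_le_sum fun y' _ => ?_
  -- the sign vector of row `x` cut to the block of `y′`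
  let μ : X → ℝ := fun x' => if blk x' = y' then (if 0 ≤ M x x' then 1 else -1) else 0
  have hloc : (B11SectG.BlockNorm.ofBlocks g blk).IsLoc y' μ := fun x' hx' => by simp [μ, hx']
  have hμ1 : (B11SectG.BlockNorm.ofBlocks g blk).loc y' μ ≤ 1 := by
    show (⨆ x' : X, if blk x' = y' then |μ x'| else 0) ≤ 1
    haveI : Nonempty X := ⟨x⟩
    refine ciSup_le fun x' => ?_
    by_cases hx' : blk x' = y'
    · simp only [hx', if_true, μ]
      split_ifs <;> simp
    · simp [hx']
  have hrow : (M *ᵥ μ) x = ∑ x', (if blk x' = y' then |M x x'| else 0) := by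
    simp only [Matrix.mulVec, dotProduct, μ]
    refine Finset.sum_congr rfl fun x' _ => ?_
    by_cases hx' : blk x' = y'
    · simp only [hx', if_true]
      split_ifs with h0
      · rw [mul_one, abs_of_nonneg h0]
      · rw [mul_neg, mul_one, abs_of_neg (lt_of_not_ge h0)]
    · simp [hx']
  have hpt : |(M *ᵥ μ) x| ≤ (B11SectG.BlockNorm.ofBlocks g blk).loc (blk x) (Matrix.mulVecLin M μ) := by
    show |(M *ᵥ μ) x| ≤ ⨆ x' : X, if blk x' = blk x then |Matrix.mulVecLin M μ x'| else 0
    refine le_trans ?_ (le_ciSup (Finite.bddAbove_range _) x)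
    simp
  have h := hM y' μ hloc (blk x)
  calc ∑ x', (if blk x' = y' then |M x x'| else 0) = (M *ᵥ μ) x := hrow.symm
    _ ≤ |(M *ᵥ μ) x| := le_abs_self _
    _ ≤ (B11SectG.BlockNorm.ofBlocks g blk).loc (blk x) (Matrix.mulVecLin M μ) := hpt
    _ ≤ K (blk x) y' * (B11SectG.BlockNorm.ofBlocks g blk).loc y' μ := h
    _ ≤ K (blk x) y' * 1 := mul_le_mul_of_nonneg_left hμ1 (hK _ _)
    _ = K (blk x) y' := mul_one _

/-- with an exponential majorant `C·e^{−δd}` and the row sum [4] (2.61) `Σ_{y′}e^{−δd(y,y′)} ≤ c`: `Σ_{x′}|M(x,x′)| ≤ C·c` — the sup letter of §1–§3, §7.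
[cite: Balaban1985BackgroundPropagators, (3.138) p.423] [cite: Balaban1984PropagatorsII, (2.51)–(2.55) p.232, (2.61) p.234] -/
theorem rowSum_le_of_hasMaj_exp (blk : X → g.Site) (M : Matrix X X ℝ) {C δ c : ℝ} (hC : 0 ≤ C) (hrs : B11SectG.RowSum g δ c)
    (hM : B11SectG.HasMaj (B11SectG.BlockNorm.ofBlocks g blk) (B11SectG.BlockNorm.ofBlocks g blk) (Matrix.mulVecLin M)
      (fun y y' => C * Real.exp (-(δ * g.dist y y')))) (x : X) :
    ∑ x', |M x x'| ≤ C * c := by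
  refine (rowSum_le_of_hasMaj_ofBlocks blk M (fun y y' => mul_nonneg hC (Real.exp_nonneg _)) hM x).trans ?_
  rw [← Finset.mul_sum]
  exact mul_le_mul_of_nonneg_left (hrs (blk x)) hC

end FromMajorant

end Literature.MathematicalPhysics.QuantumFieldTheory.Balaban1983to89.B9Thm312Positivity

end
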